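import Summits.ABC.IUTFork.Joshi.TestRealMeasureMismatch
import Summits.ABC.IUTFork.Joshi.TestRealHonestPacket
import HarnessLib

/-!
# Branch E TEST vs S — SCOPE of the «real-measure reading» of H12 (p439646 `TestRealMeasureMismatch`) at the tree's real carriers,
# and its DIRECTION-FREE twin in the verbatim container's currency, FIRING at `honestSetting` (abc-iut-E-t24, gen 7)

Proof-only record file of the abc-iut cell, block E «type Joshi's construction, test vs S» (rung LADDER-ABC:A2.E). Companion of
abc-iut-E-cx's H12 `Joshi/TestRealMeasureMismatch.lean` (p439646) / abc-iut-E-t44's `Joshi/TestRealMeasureDichotomy.lean` (p433142) and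
of abc-iut-E-t43's X-12-REAL `Joshi/TestRealIsmDichotomy.lean` (p435161) / abc-iut-E-t41's `Joshi/TestRealHonestPacket.lean` (p440805,
`honestSetting`), all consumed BY NAME; 0 `def`, no `Prop` fact, no instance, no `sorry`; no parent edited or restated. **No side is
taken** on [IUTchIII] Cor. 3.12 or on any author (Mochizuki / Scholze–Stix / Joshi / Dupuy–Hilado); typed ≠ proved ≠ endorsed; a
theorem about OUR typed volume vocabularies, nothing more. S := `Cor312Vol.PilotKummerIndRelated`.

## The question (RQ7 second read of p439646, INFO-1, abc-iut-E-t24 gen 6, STATUS 2026-08-26T12:26:08Z)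

H12's theorems are universally quantified over a **single-container real-measure reading** of ONE packet `(j, v_ℚ)`: a topological
abelian group `W` with an integral structure `Λ`, a map `e : 𝓘^ℚ(…) → W`, and the two binders
`hlogvol : ∀ A, logvol A = μ^log_Λ(e″A)/d`, `hAdm : ∀ A, Adm A ↔ 0 < μ_Λ(e″A) < ∞` (p433142's «cell's generic real-measure reading»,
`Thm311LogvolInvariance.lean`). The tree has NO kernel instantiation of this binder list (0 consumers of p439646); its docstring points to
«the Dupuy–Hilado real instantiation (p430041 / p435161)» for non-vacuity. Can H12 be made to fire, in one term, at the INHABITED real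
setting of record — abc-iut-E-t41's `honestSetting` over abc-iut-E-t43's `latticeSituationReal` (the VERBATIM container
`summandPiecesReal`: direct product regions over the summands `v⃗ ∈ Π_{α∈S^±_{j+1}} 𝕍_{v_ℚ}`, [IUTchIII] Rmk. 3.1.1 (iii) p. 95, weighted
sums of the summand log-measures, Dupuy–Hilado Def. 3.6.1)?

## What is proved

* §1 `adm_union_of_realMeasureReading` [folklore] — under `hAdm` the admissible regions of the packet are CLOSED UNDER BINARY UNIONS
  (`μ(e″A) ≤ μ(e″(A ∪ B)) ≤ μ(e″A) + μ(e″B)`).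
* §2 `summandPieces_not_adm_union` / `not_realMeasureReading_of_two_summands` [folklore] — for ANY summand container `V`
  (`Cor312Vol.SummandPieces`) and line data `D` realising it: if the packet `(j, v_ℚ)` has two distinct summand indices `v⃗₁ ≠ v⃗₂` and
  every summand carries nested admissible subsets `R_{v⃗} ⊆ R'_{v⃗}`, proper at `v⃗₁` and at `v⃗₂`, then the two direct product regions
  «`R'` with `R` in the slot `v⃗₁`» and «`R'` with `R` in the slot `v⃗₂`» are admissible but their UNION is NOT (it is not a direct
  product); hence NO `(W, Λ, e)` whatsoever satisfies H12's `hAdm` for `D` at that packet.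
* §3 `real_not_realMeasureReading` — at abc-iut-E-t43's `latticeSituationReal X hlog Aut Ism …` (ANY binders `Aut`/`Ism`, any column
  family, any column `n`) and any packet `(j, p)` over a prime `p` above which `F` has TWO DISTINCT places `v ≠ v'` (summands
  `v⃗₁ := (v,…,v)`, `v⃗₂ := (v',…,v')`; nested pair `p·(R_{v⃗})^∼ ⊊ (R_{v⃗})^∼`, admissible by abc-iut-c312-3 / p440805, distinct because
  of log-measures `−log p ≠ 0`): **H12's / p433142's binder `hAdm` is NOT instantiable — for every container `W`, integral structure `Λ`
  and reading map `e`.** So at multi-summand packets the «single-container real-measure reading» (H12, p433142) and the «verbatim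
  container reading» (`SummandPieces.Realizes`: X-06-REAL p430041, X-12-REAL p435161, `honestSetting` p440805) are DIFFERENT
  interfaces; p439646's pointer «non-vacuity of the real-measure reading: the Dupuy–Hilado real instantiation» can have a kernel form at
  most at single-summand packets (one place of `F` over `p`; the trivial archimedean container), which this file does not treat.
* §4 THE TWIN IN VERBATIM CURRENCY — `real_not_pilotKummerIndRelated_and_statement_of_ne`: H12's DIRECTION-FREE conclusion at the
  real generic carriers WITHOUT the single-container reading: for `Aut`/`Ism` with continuous members at finite places, the volume
  characters of the (Ind1)/(Ind2) generators come from p435161's `real_generator_character` (Haar moduli of `ℚ_p`-linear maps of the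
  summands), and abc-iut-E-cx-2's `not_statement_of_pilotKummerIndRelated_of_ne_of_character` (p434968) gives: admissible Θ-Kummer datum
  regions at one packet of a label in `𝔽_l^⋇`, one of them inside `Θ3`, ALL of log-volume `≠` the q-datum region's (either direction),
  Thm. 3.11 (ii)(b) for column `n` and (hρ) ⟹ `¬(S ∧ Statement)`. `honest_not_pilotKummerIndRelated_and_statement` — **it FIRES in one
  term at the inhabited `honestSetting`** (any continuous `Aut`/`Ism`, any `col`, `n`, box prime `p`) under the Corollary's two REGION
  pins (pΘ)/(pq′) — `hΘ`/`hne` supplied by p440805's `honest_hΘ`/`honest_hlt`, `Θ3` by (pΘ) — with Thm. 3.11 (ii)(b) and (hρ) kept as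
  NAMED binders exactly as in p435161's S-form (over the Dupuy–Hilado binders `(stripAutDH, ismDH)` the conjunction (hρ) ∧ (pq′) is
  refuted at `honestSetting` for `F` with a tamely ramified place by abc-iut-E-t41's `TestRealPinsEquivariance`, so there the
  instance is vacuous, like p435161's S-form; for generic `Aut`/`Ism` the binders stand; their joint inhabitation is the pins
  non-vacuity question of abc-iut-E-cx-2's p441977, not treated here).

LOCATED SENTENCE (tree currency, no side taken): «H12's exhaustiveness is stated for a reading in which admissibility is positivity and
finiteness of ONE Haar measure of the image; the cell's verbatim container at the real carriers is not of that kind as soon as a packet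
has two direct summands (admissible = direct product region is not union-closed), so H12 does not instantiate there; its conclusion
does, through the summand-wise volume characters, and holds at the inhabited honest setting under the region pins, Thm. 3.11 (ii)(b) and
(hρ).» Which (Ind2) [IUTchIII] intends and whether the Θ-hull is taken over the full orbit remain the attach points of E-LOCATION §L1 —
recorded, not decided. [claim: Mochizuki2012, status: disputed] [cite: MochizukiAbsTopIII2015, Prop. 5.7 (i)(b) p. 138]
[cite: DupuyHilado2025, Def. 3.6.1, §4.7–4.9]. Standard axioms only; R14: `Joshi/Test*`.
-/

noncomputable section

open Set MeasureTheory Function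
open scoped ENNReal Pointwise

namespace Summit.ABC.IUTFork.Joshi

open Thm311 Thm311.Real Cor312 Cor312Vol Literature.IUT.LogThetaLattice Literature.IUT.LogVolume

/-! ## 1. A single-container real-measure reading makes admissibility closed under binary unions -/

section Abstract

variable {T : ThetaIndex} {L : LogShells T} {D : MRData L} {j : T.Label} {vQ : T.VQ}
  {W : Type*} [AddCommGroup W] [TopologicalSpace W] [IsTopologicalAddGroup W] [MeasurableSpace W] [BorelSpace W]
  (Λ : IntegralStructure W) (e : L.Packet j vQ → W)

/-- **Under H12's binder `hAdm` (admissible = positive finite `μ_Λ`-measure of the image in ONE container) the admissible regions of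
the packet are closed under binary unions**: `0 < μ(e″A) ≤ μ(e″(A ∪ B)) ≤ μ(e″A) + μ(e″B) < ∞`. [folklore] -/
theorem adm_union_of_realMeasureReading
    (hAdm : ∀ A : Set (L.Packet j vQ), D.Adm j vQ A ↔ 0 < Λ.haar (e '' A) ∧ Λ.haar (e '' A) < ∞)
    {A B : Set (L.Packet j vQ)} (hA : D.Adm j vQ A) (hB : D.Adm j vQ B) : D.Adm j vQ (A ∪ B) := by
  rw [hAdm] at hA hB ⊢
  rw [Set.image_union]
  exact ⟨hA.1.trans_le (measure_mono Set.subset_union_left),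
    (measure_union_le _ _).trans_lt (ENNReal.add_lt_top.2 ⟨hA.2, hB.2⟩)⟩

/-! ## 2. The verbatim container: direct product regions are NOT union-closed at a packet with two summands -/

variable (V : SummandPieces L)

/-- Replacing one slot of a family of admissible summand subsets by another admissible subset keeps every slot admissible. [folklore] -/
theorem summand_adm_update [DecidableEq (V.E j vQ)] {R R' : ∀ e, Set (V.X j vQ e)}
    (hR : ∀ e, V.adm j vQ e (R e)) (hR' : ∀ e, V.adm j vQ e (R' e)) (e₀ : V.E j vQ) :
    ∀ e, V.adm j vQ e (update R' e₀ (R e₀) e) := fun e => by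
  rcases eq_or_ne e e₀ with rfl | h
  · rw [update_self]; exact hR e
  · rw [update_of_ne h]; exact hR' e

/-- **Direct product regions are not closed under unions.** With two distinct summand indices `v⃗₁ ≠ v⃗₂` and nested admissible
subsets `R_{v⃗} ⊆ R'_{v⃗}` in every summand, proper at `v⃗₁` and at `v⃗₂`, the preimages under the comparison `e` of the products
«`R'` with `R` in slot `v⃗₁`» and «`R'` with `R` in slot `v⃗₂`» have a union that is NOT admissible in the verbatim container
(`SummandPieces.Adm` = «the image is a direct product of admissible subsets», [IUTchIII] Rmk. 3.1.1 (iii) p. 95): a point with a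
coordinate outside `R` in BOTH slots would have to belong to it. [folklore] -/
theorem summandPieces_not_adm_union [DecidableEq (V.E j vQ)] {e₁ e₂ : V.E j vQ} (hne : e₁ ≠ e₂)
    {R R' : ∀ e, Set (V.X j vQ e)} (hR : ∀ e, V.adm j vQ e (R e)) (hsub : ∀ e, R e ⊆ R' e)
    (h₁ : R e₁ ≠ R' e₁) (h₂ : R e₂ ≠ R' e₂) :
    ¬ V.Adm j vQ (V.e j vQ ⁻¹' Set.pi univ (update R' e₁ (R e₁)) ∪ V.e j vQ ⁻¹' Set.pi univ (update R' e₂ (R e₂))) := by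
  rintro ⟨Q, hQ, -⟩
  rw [Set.image_union, Set.image_preimage_eq _ (V.e_surjective j vQ),
    Set.image_preimage_eq _ (V.e_surjective j vQ)] at hQ
  obtain ⟨x₁, hx₁', hx₁⟩ := Set.exists_of_ssubset ((hsub e₁).ssubset_of_ne h₁)
  obtain ⟨x₂, hx₂', hx₂⟩ := Set.exists_of_ssubset ((hsub e₂).ssubset_of_ne h₂)
  choose r hr using fun e => V.adm_nonempty j vQ e _ (hR e)
  -- every point of either product has all its coordinates in `Q`
  have hS : ∀ z : ∀ e, V.X j vQ e,
      z ∈ Set.pi univ (update R' e₁ (R e₁)) ∪ Set.pi univ (update R' e₂ (R e₂)) → ∀ e, z e ∈ Q e :=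
    fun z hz e => Set.mem_univ_pi.1 (hQ ▸ hz) e
  -- `x₁ ∈ Q v⃗₁`: the point `r` with `x₁` in slot `v⃗₁` lies in the second product
  have hQ₁ : x₁ ∈ Q e₁ := by
    have h := hS (update r e₁ x₁) (Or.inr (Set.mem_univ_pi.2 fun e => by
      rcases eq_or_ne e e₂ with rfl | he₂
      · rw [update_self, update_of_ne hne.symm]; exact hr _
      · rw [update_of_ne he₂]
        rcases eq_or_ne e e₁ with rfl | he₁
        · rw [update_self]; exact hx₁'
        · rw [update_of_ne he₁]; exact hsub _ (hr _))) e₁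
    rwa [update_self] at h
  -- `x₂ ∈ Q v⃗₂`: symmetrically
  have hQ₂ : x₂ ∈ Q e₂ := by
    have h := hS (update r e₂ x₂) (Or.inl (Set.mem_univ_pi.2 fun e => by
      rcases eq_or_ne e e₁ with rfl | he₁
      · rw [update_self, update_of_ne hne]; exact hr _
      · rw [update_of_ne he₁]
        rcases eq_or_ne e e₂ with rfl | he₂
        · rw [update_self]; exact hx₂'
        · rw [update_of_ne he₂]; exact hsub _ (hr _))) e₂
    rwa [update_self] at h
  -- `r_{v⃗} ∈ Q v⃗`: `r` lies in the first product
  have hQr : ∀ e, r e ∈ Q e := hS r (Or.inl (Set.mem_univ_pi.2 fun e => by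
    rcases eq_or_ne e e₁ with rfl | he₁
    · rw [update_self]; exact hr _
    · rw [update_of_ne he₁]; exact hsub _ (hr _)))
  -- the mixed point lies in `Π Q` but in neither product
  have hz₁ : update (update r e₁ x₁) e₂ x₂ e₁ = x₁ := by rw [update_of_ne hne, update_self]
  have hz₂ : update (update r e₁ x₁) e₂ x₂ e₂ = x₂ := update_self ..
  have hzQ : update (update r e₁ x₁) e₂ x₂ ∈ Set.pi univ Q := Set.mem_univ_pi.2 fun e => by
    rcases eq_or_ne e e₂ with rfl | he₂
    · rw [hz₂]; exact hQ₂
    · rcases eq_or_ne e e₁ with rfl | he₁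
      · rw [hz₁]; exact hQ₁
      · rw [update_of_ne he₂, update_of_ne he₁]; exact hQr e
  rw [← hQ] at hzQ
  rcases hzQ with h | h
  · have h' := Set.mem_univ_pi.1 h e₁
    rw [hz₁, update_self] at h'
    exact hx₁ h'
  · have h' := Set.mem_univ_pi.1 h e₂
    rw [hz₂, update_self] at h'
    exact hx₂ h'

/-- **No single-container real-measure reading at a packet with two summands.** For line data `D` REALISING the verbatim container
`V` (`SummandPieces.Realizes`), at a packet with two distinct summand indices carrying nested admissible pairs proper at both, NO
topological abelian group `W`, integral structure `Λ` and map `e` satisfy H12's binder `hAdm : ∀ A, Adm A ↔ 0 < μ_Λ(e″A) < ∞`.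
[folklore] -/
theorem not_realMeasureReading_of_two_summands (hD : V.Realizes D) {e₁ e₂ : V.E j vQ} (hne : e₁ ≠ e₂)
    {R R' : ∀ e, Set (V.X j vQ e)} (hR : ∀ e, V.adm j vQ e (R e)) (hR' : ∀ e, V.adm j vQ e (R' e))
    (hsub : ∀ e, R e ⊆ R' e) (h₁ : R e₁ ≠ R' e₁) (h₂ : R e₂ ≠ R' e₂) :
    ¬ ∀ A : Set (L.Packet j vQ), D.Adm j vQ A ↔ 0 < Λ.haar (e '' A) ∧ Λ.haar (e '' A) < ∞ := by
  classical
  intro hAdm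
  exact summandPieces_not_adm_union V hne hR hsub h₁ h₂ ((hD.adm_iff j vQ _).1
    (adm_union_of_realMeasureReading Λ e hAdm
      ((hD.adm_iff j vQ _).2 (V.adm_preimage_pi j vQ (summand_adm_update V hR hR' e₁)))
      ((hD.adm_iff j vQ _).2 (V.adm_preimage_pi j vQ (summand_adm_update V hR hR' e₂)))))

end Abstract

/-! ## 3. At the tree's real carriers: H12's binder list is not instantiable at a packet over two places -/

section Prime

variable (p : ℕ) [hp : Fact p.Prime] {I : Type} [Fintype I] [DecidableEq I] [Nonempty I]
  (k : I → Type) [∀ i, NontriviallyNormedField (k i)] [∀ i, NormedAlgebra ℚ_[p] (k i)]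
  [∀ i, IsUltrametricDist (k i)] [∀ i, ProperSpace (k i)]

omit [Fintype I] [DecidableEq I] [Nonempty I] [∀ i, IsUltrametricDist (k i)] [∀ i, ProperSpace (k i)] in
/-- `p·(R_I)^∼ ⊆ (R_I)^∼` (`(R_I)^∼` is a subring containing `p`). [cite: Mochizuki2012, IUTchIV Prop. 1.1 p. 9] -/
theorem ppow_one_smul_normalizedPacket_subset :
    ppow p k 1 • (normalizedPacket p k : Set (PacketAlgebra p k)) ⊆ normalizedPacket p k := by
  have h1 : ppow p k 1 ∈ normalizedPacket p k := by
    rw [ppow, zpow_one, map_natCast]; exact natCast_mem _ p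
  rintro _ ⟨x, hx, rfl⟩
  exact (normalizedPacket p k).mul_mem h1 hx

/-- `p·(R_I)^∼ ≠ (R_I)^∼` (log-measures `−log p ≠ 0`, abc-iut-c312-3's modulus law via p440805). [cite: Mochizuki2012, IUTchIV Prop. 1.4 (i) p. 13] -/
theorem ppow_one_smul_normalizedPacket_ne :
    ppow p k 1 • (normalizedPacket p k : Set (PacketAlgebra p k)) ≠ normalizedPacket p k := fun h => by
  have h2 := packetLogμ_ppow_one_smul_normalizedPacket p k
  rw [h, packetLogμ_normalizedPacket] at h2
  have h3 : (0 : ℝ) < Real.log p := Real.log_pos (by exact_mod_cast hp.out.one_lt)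
  linarith

end Prime

section RealCarriers

variable {F : Type} [Field F] [NumberField F] (X : PilotData F) {logv : PadicLogs F} (hlog : LogvAnalytic logv)
  (Aut Ism : ∀ x : Place F, Set (Carrier x ≃ₗ[ℚ] Carrier x))
  (hAut : ∀ x, LinearEquiv.refl ℚ (Carrier x) ∈ Aut x) (hIsm : ∀ x, LinearEquiv.refl ℚ (Carrier x) ∈ Ism x)
  (M : Type) [Field M] [NumberField M]
  (archPk : ∀ (j : (thetaIndex X).Label) (vQ : (thetaIndex X).VQ), Set ((logShells X logv Aut Ism hAut hIsm).Packet j vQ))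
  (archSub : ∀ (j : (thetaIndex X).Label) (v : (thetaIndex X).V),
    Set ((logShells X logv Aut Ism hAut hIsm).Packet j ((thetaIndex X).over v)))
  (Ψ : ℤ → ∀ v : (thetaIndex X).V, v ∈ (thetaIndex X).Vbad → Set ((logShells X logv Aut Ism hAut hIsm).StarPacket v))
  (act : ℤ → ∀ v : (thetaIndex X).V, v ∈ (thetaIndex X).Vbad →
    (logShells X logv Aut Ism hAut hIsm).StarPacket v → Module.End ℚ ((logShells X logv Aut Ism hAut hIsm).StarPacket v))
  (Mmod : ℤ → ∀ j : (thetaIndex X).LabelStar, Set ((logShells X logv Aut Ism hAut hIsm).GlobalPacket j.1))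
  (region : ℤ → ∀ j : (thetaIndex X).LabelStar, FinDivisor M → ∀ vQ : (thetaIndex X).VQ,
    Set ((logShells X logv Aut Ism hAut hIsm).Packet j.1 vQ))
  (col : ℤ → Column (logShells X logv Aut Ism hAut hIsm)) (n : ℤ) (p : ℕ) [hp : Fact p.Prime]

/-- **H12's / p433142's binder `hAdm` is NOT INSTANTIABLE at the verbatim real container over two places.** At abc-iut-E-t43's
`latticeSituationReal` (ANY `Aut`/`Ism`, column family, column `n`) and any packet `(j, p)` over a prime `p` above which `F` has two
distinct places `v ≠ v'`: for EVERY topological abelian group `W`, integral structure `Λ` and map `e`, the line-`n` admissibility is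
not «`0 < μ_Λ(e″−) < ∞`» (summands `(v,…,v) ≠ (v',…,v')`, nested pairs `p·(R_{v⃗})^∼ ⊊ (R_{v⃗})^∼`). [folklore] -/
theorem real_not_realMeasureReading (j : (thetaIndex X).Label)
    (v v' : (thetaIndex X).Fibre (Sum.inr (ratPrime p))) (hvv' : v ≠ v')
    {W : Type*} [AddCommGroup W] [TopologicalSpace W] [IsTopologicalAddGroup W] [MeasurableSpace W] [BorelSpace W]
    (Λ : IntegralStructure W) (e : (logShells X logv Aut Ism hAut hIsm).Packet j (.inr (ratPrime p)) → W) :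
    ¬ ∀ A : Set ((logShells X logv Aut Ism hAut hIsm).Packet j (.inr (ratPrime p))),
      ((latticeSituationReal X hlog Aut Ism hAut hIsm M archPk archSub Ψ act Mmod region col).D n).Adm j (.inr (ratPrime p)) A ↔
        0 < Λ.haar (e '' A) ∧ Λ.haar (e '' A) < ∞ := by
  haveI : Nonempty ((thetaIndex X).Caps j) := ⟨0⟩
  exact not_realMeasureReading_of_two_summands Λ e (summandPiecesReal X hlog Aut Ism hAut hIsm)
    (realizes_latticeSituationReal X hlog Aut Ism hAut hIsm M archPk archSub Ψ act Mmod region col n)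
    (e₁ := fun _ => v) (e₂ := fun _ => v') (fun h => hvv' (congrFun h 0))
    (R := fun e => ppow p ((presAt X hlog (ratPrime p)).kk e) 1 •
      (normalizedPacket p ((presAt X hlog (ratPrime p)).kk e) : Set ((presAt X hlog (ratPrime p)).X e)))
    (R' := fun e => (normalizedPacket p ((presAt X hlog (ratPrime p)).kk e) : Set ((presAt X hlog (ratPrime p)).X e)))
    (fun e => packetAdm_ppow_one_smul_normalizedPacket p ((presAt X hlog (ratPrime p)).kk e))
    (fun e => (presAt X hlog (ratPrime p)).packetAdm_normalizedPacket_kk e)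
    (fun e => ppow_one_smul_normalizedPacket_subset p _)
    (ppow_one_smul_normalizedPacket_ne p _) (ppow_one_smul_normalizedPacket_ne p _)

/-! ## 4. The twin in verbatim currency: direction-free `¬(S ∧ Statement)` at the real generic carriers; it FIRES at `honestSetting` -/

variable {n p}
variable {P : Cor312.Setting (latticeSituationReal X hlog Aut Ism hAut hIsm M archPk archSub Ψ act Mmod region col).toSituation}
  (ρ : (∀ v : (thetaIndex X).V, v ∈ (thetaIndex X).Vbad → Set ((logShells X logv Aut Ism hAut hIsm).StarPacket v)) →
    ∀ (j : (thetaIndex X).Label) (vQ : (thetaIndex X).VQ), Set ((logShells X logv Aut Ism hAut hIsm).Packet j vQ))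
  (qK : ∀ v : (thetaIndex X).V, v ∈ (thetaIndex X).Vbad → Set ((logShells X logv Aut Ism hAut hIsm).StarPacket v))

/-- **H12's conclusion WITHOUT the single-container reading, at the real generic carriers.** For `Aut`/`Ism` whose members at finite
places are continuous, any column family, any `Cor312.Setting`, Thm. 3.11 (ii)(b) for column `n` and the
(hρ)-equivariance of `ρ`: at one packet of a label in `𝔽_l^⋇` with admissible Θ-Kummer datum regions, one of them inside `Θ3`, ALL of
log-volume `≠` the q-datum region's (EITHER direction) — `¬(S ∧ Statement)`. Characters: p435161 `real_generator_character`; the rest: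
p434968 `not_statement_of_pilotKummerIndRelated_of_ne_of_character`. Located, not adjudicated. [claim: Mochizuki2012, status: disputed] -/
theorem real_not_pilotKummerIndRelated_and_statement_of_ne
    (hAc : ∀ (v : IsDedekindDomain.HeightOneSpectrum (NumberField.RingOfIntegers F)), ∀ g ∈ Aut (.inr v), Continuous g)
    (hIc : ∀ (v : IsDedekindDomain.HeightOneSpectrum (NumberField.RingOfIntegers F)), ∀ g ∈ Ism (.inr v), Continuous g)
    (hKumB : (col P.n).KummerB ((latticeSituationReal X hlog Aut Ism hAut hIsm M archPk archSub Ψ act Mmod region col).D P.n))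
    (hρ : ∀ Φ ∈ Subgroup.closure ((logShells X logv Aut Ism hAut hIsm).Ind1Family ∪ (logShells X logv Aut Ism hAut hIsm).Ind2Family),
      ∀ (Ψ' : ∀ v : (thetaIndex X).V, v ∈ (thetaIndex X).Vbad → Set ((logShells X logv Aut Ism hAut hIsm).StarPacket v))
        (j : (thetaIndex X).Label) (vQ : (thetaIndex X).VQ),
        ρ (fun v hv => (logShells X logv Aut Ism hAut hIsm).starAut Φ v '' Ψ' v hv) j vQ = Φ j vQ '' ρ Ψ' j vQ)
    {i : Fin (thetaIndex X).lstar} {vQ : (thetaIndex X).VQ}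
    (hΘ : ∀ m : ℤ, ((latticeSituationReal X hlog Aut Ism hAut hIsm M archPk archSub Ψ act Mmod region col).D P.n).Adm
      (Setting.labelSucc i) vQ (ρ ((col P.n).frobΨ m) (Setting.labelSucc i) vQ))
    (hΘ3 : ∃ m : ℤ, ρ ((col P.n).frobΨ m) (Setting.labelSucc i) vQ ⊆ P.thetaRegion3 (Setting.labelSucc i) vQ)
    (hne : ∀ m : ℤ, ((latticeSituationReal X hlog Aut Ism hAut hIsm M archPk archSub Ψ act Mmod region col).D P.n).logvol
        (Setting.labelSucc i) vQ (ρ ((col P.n).frobΨ m) (Setting.labelSucc i) vQ) ≠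
      ((latticeSituationReal X hlog Aut Ism hAut hIsm M archPk archSub Ψ act Mmod region col).D P.n).logvol
        (Setting.labelSucc i) vQ (ρ qK (Setting.labelSucc i) vQ)) :
    ¬ (PilotKummerIndRelated (latticeSituationReal X hlog Aut Ism hAut hIsm M archPk archSub Ψ act Mmod region col) P ρ qK ∧
        P.Statement) := by
  classical
  rintro ⟨hS, hSt⟩
  have hD := realizes_latticeSituationReal X hlog Aut Ism hAut hIsm M archPk archSub Ψ act Mmod region col P.n
  have hgen := fun (Φ : (logShells X logv Aut Ism hAut hIsm).PacketAut)
      (hΦ : Φ ∈ (logShells X logv Aut Ism hAut hIsm).Ind1Family ∪ (logShells X logv Aut Ism hAut hIsm).Ind2Family) =>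
    real_generator_character (hAut := hAut) (hIsm := hIsm) hAc hIc hD hΦ (Setting.labelSucc i) vQ
  -- the character of a generator (junk `0` elsewhere)
  let c : (logShells X logv Aut Ism hAut hIsm).PacketAut → ℝ := fun Φ =>
    if hΦ : Φ ∈ (logShells X logv Aut Ism hAut hIsm).Ind1Family ∪ (logShells X logv Aut Ism hAut hIsm).Ind2Family then
      Classical.choose (hgen Φ hΦ) else 0
  have hc : ∀ Φ (hΦ : Φ ∈ (logShells X logv Aut Ism hAut hIsm).Ind1Family ∪ (logShells X logv Aut Ism hAut hIsm).Ind2Family),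
      (∀ A, ((latticeSituationReal X hlog Aut Ism hAut hIsm M archPk archSub Ψ act Mmod region col).D P.n).Adm
          (Setting.labelSucc i) vQ A ↔
        ((latticeSituationReal X hlog Aut Ism hAut hIsm M archPk archSub Ψ act Mmod region col).D P.n).Adm
          (Setting.labelSucc i) vQ (Φ (Setting.labelSucc i) vQ '' A)) ∧
      ∀ A, ((latticeSituationReal X hlog Aut Ism hAut hIsm M archPk archSub Ψ act Mmod region col).D P.n).Adm
          (Setting.labelSucc i) vQ A →
        ((latticeSituationReal X hlog Aut Ism hAut hIsm M archPk archSub Ψ act Mmod region col).D P.n).logvol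
            (Setting.labelSucc i) vQ (Φ (Setting.labelSucc i) vQ '' A) =
          ((latticeSituationReal X hlog Aut Ism hAut hIsm M archPk archSub Ψ act Mmod region col).D P.n).logvol
            (Setting.labelSucc i) vQ A + c Φ := fun Φ hΦ => by
    have h := Classical.choose_spec (hgen Φ hΦ)
    simp only [c, dif_pos hΦ]
    exact h
  exact (not_statement_of_pilotKummerIndRelated_of_ne_of_character
    (S := latticeSituationReal X hlog Aut Ism hAut hIsm M archPk archSub Ψ act Mmod region col) (P := P) (ρ := ρ) (qK := qK)
    hKumB hρ c (fun Φ hΦ => (hc Φ hΦ).1)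
    (fun Φ hΦ => (hc Φ hΦ).2)
    (fun A B hA hB hAB => SummandPieces.logvol_mono_of_realizes (summandPiecesReal X hlog Aut Ism hAut hIsm) hD hA hB hAB)
    hΘ hΘ3 hne hS).1 hSt

/-- **H12's conclusion FIRES IN ONE TERM AT THE INHABITED HONEST SETTING.** At abc-iut-E-t41's `honestSetting` (p440805) — for EVERY
`Aut`/`Ism` with continuous members at finite places, column family, column `n`, box prime `p`, and every reading `ρ` / q-datum `qK`
satisfying the Corollary's two REGION pins there ((pΘ) `thetaRegion m = ρ (Ψ^{(m)})`, (pq′) `qRegion = ρ qK`) — the packet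
`(j = 1, v_ℚ = p)` has admissible Θ-datum regions (`honest_hΘ`) inside `Θ3` (by (pΘ)), of log-volume `< 0 =` the q-datum region's
(`honest_hlt`), so under Thm. 3.11 (ii)(b) for column `n` and (hρ) (NAMED binders, as in p435161's S-form): `¬(S ∧ Statement)`.
Located, not adjudicated. [claim: Mochizuki2012, status: disputed] -/
theorem honest_not_pilotKummerIndRelated_and_statement
    (hAc : ∀ (v : IsDedekindDomain.HeightOneSpectrum (NumberField.RingOfIntegers F)), ∀ g ∈ Aut (.inr v), Continuous g)
    (hIc : ∀ (v : IsDedekindDomain.HeightOneSpectrum (NumberField.RingOfIntegers F)), ∀ g ∈ Ism (.inr v), Continuous g)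
    (hΘpin : ∀ (m : ℤ) (j : (thetaIndex X).Label) (vQ : (thetaIndex X).VQ),
      (honestSetting X hlog Aut Ism hAut hIsm M archPk archSub Ψ act Mmod region col n p).thetaRegion m j vQ =
        ρ ((col n).frobΨ m) j vQ)
    (hqpin : ∀ (j : (thetaIndex X).Label) (vQ : (thetaIndex X).VQ),
      (honestSetting X hlog Aut Ism hAut hIsm M archPk archSub Ψ act Mmod region col n p).qRegion j vQ = ρ qK j vQ)
    (hKumB : (col n).KummerB ((latticeSituationReal X hlog Aut Ism hAut hIsm M archPk archSub Ψ act Mmod region col).D n))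
    (hρ : ∀ Φ ∈ Subgroup.closure ((logShells X logv Aut Ism hAut hIsm).Ind1Family ∪ (logShells X logv Aut Ism hAut hIsm).Ind2Family),
      ∀ (Ψ' : ∀ v : (thetaIndex X).V, v ∈ (thetaIndex X).Vbad → Set ((logShells X logv Aut Ism hAut hIsm).StarPacket v))
        (j : (thetaIndex X).Label) (vQ : (thetaIndex X).VQ),
        ρ (fun v hv => (logShells X logv Aut Ism hAut hIsm).starAut Φ v '' Ψ' v hv) j vQ = Φ j vQ '' ρ Ψ' j vQ) :
    ¬ (PilotKummerIndRelated (latticeSituationReal X hlog Aut Ism hAut hIsm M archPk archSub Ψ act Mmod region col)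
          (honestSetting X hlog Aut Ism hAut hIsm M archPk archSub Ψ act Mmod region col n p) ρ qK ∧
        (honestSetting X hlog Aut Ism hAut hIsm M archPk archSub Ψ act Mmod region col n p).Statement) :=
  real_not_pilotKummerIndRelated_and_statement_of_ne X hlog Aut Ism hAut hIsm M archPk archSub Ψ act Mmod region col ρ qK
    hAc hIc hKumB hρ
    (i := ⟨0, lt_of_lt_of_le Nat.zero_lt_two (thetaIndex X).two_le_lstar⟩) (vQ := .inr (ratPrime p))
    (fun m => honest_hΘ ρ hΘpin m _ _)
    ⟨0, (hΘpin 0 _ _).symm.subset.trans (Set.subset_iUnion (fun m =>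
        (honestSetting X hlog Aut Ism hAut hIsm M archPk archSub Ψ act Mmod region col n p).thetaRegion m _ _) 0)⟩
    (fun m => (honest_hlt ρ qK hΘpin hqpin m _).ne)

end RealCarriers

end Summit.ABC.IUTFork.Joshi

end
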